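import Literature.Analysis.FluidPDE.SereginSverakLocalEnergy
import Literature.Analysis.FluidPDE.SereginZajaczkowski2007
import Literature.Analysis.FluidPDE.WeakGradientSlicing
import Literature.Analysis.FluidPDE.CylindricalIntegration
import Literature.Analysis.FunctionSpaces.SobolevBallScaling
import Mathlib.MeasureTheory.Integral.MeanInequalities
import HarnessLib

/-!
# Seregin–Šverák 2009, proof of Lemma 3.6: the cubic term under the axis decay `|v| ≤ C/|x'|`

G. Seregin, V. Šverák, *On Type I singularities of the local axi-symmetric solutions of the
Navier–Stokes equations*, Comm. PDE 34 (2009), 171–201 = arXiv:0804.1803 (labels and pages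
refer to the arXiv version). Lemma 3.6 (arXiv p. 10) is Lemma 3.5 — the scaled energy bound
`A + E + C + D ≤ C₁` at the axis centres `z_b = (b e₃, 0)`, `|b| ≤ 1/4`, `0 < r < 1/4` — under
the hypotheses of Theorem 3.2, i.e. with the Type I bound (r3) replaced by (r2) and the axis
decay (r4) `|v(x,t)| ≤ C/|x'|` a.e. in `Q`; it is "proved in the same way as Lemma 3.5 and even
easier because main inequality (as11) can be established with the help of the case `s = s₁`,
`l = l₁` only". That case is the display (as8) (arXiv p. 9): with the weighted bound
`|x'||v| ≤ C₂` on `Q(1/2)` the multiplicative inequality (as2) of [S10] (Hölder's inequality and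
a Gagliardo–Nirenberg inequality) gives

  `C(z_b, r; v) ≤ c A^{1/58}(z_b, r; v) (C₂^{10})^{7/58} (E(z_b, r; v) + A(z_b, r; v))^{51/58}`,

a bound for the cubic functional `C` by a power `< 1` of `E + A` times a power of the constant in
the weighted bound, from which (as11) `C ≤ ε (E + A) + f₁(ε, C)` follows by Young's inequality.

This file PROVES an estimate of exactly this shape, with the tree's Sobolev inequality on balls
in place of the special Gagliardo–Nirenberg inequality of [S10] (whence different, immaterial,
exponents): for `u` with a weak spatial gradient `G` on `Q = 𝒞 × ]-1, 0[` and
`|x'| ‖u‖ ≤ C` a.e. on `Q` (hypothesis (r4) of Thm. 3.2 in its junk-free form),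

  `C(z_b, r; u) ≤ K₁ (C + 1)^{6/5} (A(z_b, 2r; u) + E(z_b, 2r; ∇u))^{9/10}`

for all `|b| ≤ 1/4`, `0 < r ≤ 3/8`, with an absolute constant `K₁`
(`SereginSverak2009.exists_cubicC_le_of_axisDecay`). The doubled radius on the right comes from
applying the Sobolev inequality on the ball `B(b e₃, 2r) ⊇ 𝒞(b e₃, r)`; it is harmless in the
iteration of Lemma 3.5/3.6 (companion file `SereginSverakScaledEnergy36.lean`, where the
`ε`-form (as11) and Lemma 3.6 are derived).

## The proof

Fix `t`. On the ball `B = B(b e₃, 2r)`, with the weight `w = |x'|` and `K = C + 1`, the a.e.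
bound `w |u| ≤ K` gives `|u|³ = |u|^{6/5} |u|^{9/5} ≤ K^{6/5} w^{-6/5} |u|^{9/5}`, so by Hölder's
inequality with exponents `10/7` and `10/3` (`lintegral_cube_le_weighted`)

  `∫_B |u(t)|³ ≤ K^{6/5} (∫_B |x'|^{-12/7} dx)^{7/10} ‖u(t)‖_{L⁶(B)}^{9/5}`.

Here `∫_{𝒞(b e₃, ρ)} |x'|^{-12/7} dx = 2ρ · ρ^{2/7} ∫_{B₁ ⊂ ℝ²} |w|^{-12/7} dw` is finite and
scales like `ρ^{9/7}` (`lintegral_inv_cylRadius_rpow_spaceCyl`: Fubini in `(x₃, x')` through the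
tree's `cylSplit`, the planar homothety, and `12/7 < 2`), and the scale-invariant Sobolev
inequality on balls for the slice `u(t) ∈ W^{1,2}(B)` (the tree's
`FunctionSpaces.exists_eLpNorm_le_ball`; the slices have the weak derivatives `G(t)` for a.e. `t`,
`HasWeakSpatialGradientOn.ae_hasWeakFDerivOn_slice`) gives
`‖u(t)‖_{L⁶(B)}^{9/5} ≤ C_S ((2r)⁻² ∫_B |u(t)|² + ∫_B |G(t)|²)^{9/10}`. Integrating over
`t ∈ ]-r², 0[` with Hölder's inequality in time (`∫ X^{9/10} ≤ r^{1/5} (∫ X)^{9/10}`) and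
`∫_B |u(t)|² ≤ 2r A(z_b, 2r)` for a.e. `t`, `∫∫ |G|² ≤ 2r E(z_b, 2r)`, all powers of `r` cancel
(`radius_powers_identity`) and the estimate follows.

## References

* G. Seregin, V. Šverák, Comm. PDE 34 (2009), 171–201, arXiv:0804.1803, §3: Thm. 3.2 (r4),
  (as2)–(as3), Lemma 3.5 and its proof, (as7)–(as8), (as11); Lemma 3.6 (arXiv pp. 9–10).
  [`SereginSverak2009`]
* G. Seregin, W. Zajaczkowski, *A sufficient condition of local regularity for the
  Navier–Stokes equations*, Zap. Nauchn. Sem. POMI 336 (2006), 46–54 (the paper's [S10]).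
-/

noncomputable section

open MeasureTheory Set Function Filter Topology TopologicalSpace Metric Module
open scoped NNReal ENNReal InnerProductSpace RealInnerProductSpace

namespace Literature.Analysis.FluidPDE

namespace SereginSverak2009

/-- Local notation for physical space `ℝ³ = EuclideanSpace ℝ (Fin 3)`. -/
local notation "ℝ³" => EuclideanSpace ℝ (Fin 3)
/-- Local notation for the horizontal plane `ℝ² = EuclideanSpace ℝ (Fin 2)`. -/
local notation "ℝ²" => EuclideanSpace ℝ (Fin 2)

/-! ### A weighted Hölder inequality -/

/-- **The weighted Hölder step of (as8).** On any measure space, if `w f ≤ K` a.e. for a weight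
`w` and `0 < K < ∞`, then `∫ f³ ≤ K^{6/5} (∫ w^{-12/7})^{7/10} (∫ f⁶)^{3/10}`: write
`f³ = f^{6/5} f^{9/5} ≤ (K/w)^{6/5} f^{9/5}` and apply Hölder's inequality with exponents `10/7`
and `10/3`. [cite: SereginSverak2009, proof of Lemma 3.5, (as2) and (as8) (arXiv p. 9)] -/
theorem lintegral_cube_le_weighted {α : Type*} [MeasurableSpace α] (μ : Measure α)
    {f w : α → ℝ≥0∞} (hf : AEMeasurable f μ) (hw : AEMeasurable w μ) {K : ℝ≥0∞} (hK : K ≠ 0)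
    (hKt : K ≠ ∞) (hfw : ∀ᵐ x ∂μ, w x * f x ≤ K) :
    ∫⁻ x, f x ^ (3 : ℕ) ∂μ ≤ K ^ (6 / 5 : ℝ) * (∫⁻ x, (w x)⁻¹ ^ (12 / 7 : ℝ) ∂μ) ^ (7 / 10 : ℝ) *
      (∫⁻ x, f x ^ (6 : ℝ) ∂μ) ^ (3 / 10 : ℝ) := by
  -- pointwise: `f ≤ K w⁻¹`, hence `f³ = f^{6/5} f^{9/5} ≤ K^{6/5} (w⁻¹)^{6/5} f^{9/5}`
  have hpt : ∀ᵐ x ∂μ, f x ^ (3 : ℕ) ≤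
      K ^ (6 / 5 : ℝ) * ((w x)⁻¹ ^ (6 / 5 : ℝ) * f x ^ (9 / 5 : ℝ)) := by
    filter_upwards [hfw] with x hx
    have h1 : f x ≤ K / w x := by
      rw [ENNReal.le_div_iff_mul_le (Or.inr hK) (Or.inr hKt), mul_comm]
      exact hx
    have h2 : f x ^ (6 / 5 : ℝ) ≤ K ^ (6 / 5 : ℝ) * (w x)⁻¹ ^ (6 / 5 : ℝ) := by
      rw [← ENNReal.mul_rpow_of_nonneg _ _ (by norm_num), ← div_eq_mul_inv]
      exact ENNReal.rpow_le_rpow h1 (by norm_num)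
    have h3 : f x ^ (3 : ℕ) = f x ^ (6 / 5 : ℝ) * f x ^ (9 / 5 : ℝ) := by
      rw [← ENNReal.rpow_add_of_nonneg _ _ (by norm_num) (by norm_num), ← ENNReal.rpow_natCast]
      norm_num
    rw [h3, ← mul_assoc]
    exact mul_le_mul_left h2 _
  -- Hölder with exponents `10/7` and `10/3`
  have hpq : (10 / 7 : ℝ).HolderConjugate (10 / 3) :=
    Real.holderConjugate_iff.2 ⟨by norm_num, by norm_num⟩
  have hH := ENNReal.lintegral_mul_le_Lp_mul_Lq μ hpq
    (f := fun x => (w x)⁻¹ ^ (6 / 5 : ℝ)) (g := fun x => f x ^ (9 / 5 : ℝ))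
    ((hw.inv).pow_const _) (hf.pow_const _)
  have e1 : ∀ x, ((w x)⁻¹ ^ (6 / 5 : ℝ)) ^ (10 / 7 : ℝ) = (w x)⁻¹ ^ (12 / 7 : ℝ) := fun x => by
    rw [← ENNReal.rpow_mul]; norm_num
  have e2 : ∀ x, (f x ^ (9 / 5 : ℝ)) ^ (10 / 3 : ℝ) = f x ^ (6 : ℝ) := fun x => by
    rw [← ENNReal.rpow_mul]; norm_num
  simp only [Pi.mul_apply, e1, e2] at hH
  rw [show (1 : ℝ) / (10 / 7) = 7 / 10 by norm_num, show (1 : ℝ) / (10 / 3) = 3 / 10 by norm_num]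
    at hH
  have hKt' : K ^ (6 / 5 : ℝ) ≠ ∞ := ENNReal.rpow_ne_top_of_nonneg (by norm_num) hKt
  calc ∫⁻ x, f x ^ (3 : ℕ) ∂μ
      ≤ ∫⁻ x, K ^ (6 / 5 : ℝ) * ((w x)⁻¹ ^ (6 / 5 : ℝ) * f x ^ (9 / 5 : ℝ)) ∂μ :=
        lintegral_mono_ae hpt
    _ = K ^ (6 / 5 : ℝ) * ∫⁻ x, (w x)⁻¹ ^ (6 / 5 : ℝ) * f x ^ (9 / 5 : ℝ) ∂μ :=
        lintegral_const_mul' _ _ hKt'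
    _ ≤ K ^ (6 / 5 : ℝ) * ((∫⁻ x, (w x)⁻¹ ^ (12 / 7 : ℝ) ∂μ) ^ (7 / 10 : ℝ) *
          (∫⁻ x, f x ^ (6 : ℝ) ∂μ) ^ (3 / 10 : ℝ)) := by gcongr
    _ = _ := by ring

/-- Hölder against the constant `1`: `∫ f^{9/10} ≤ μ(univ)^{1/10} (∫ f)^{9/10}` (the time
integration of the slice estimates). [folklore] -/
theorem lintegral_rpow_nine_tenths_le {α : Type*} [MeasurableSpace α] (μ : Measure α)
    {f : α → ℝ≥0∞} (hf : AEMeasurable f μ) :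
    ∫⁻ x, f x ^ (9 / 10 : ℝ) ∂μ ≤ (μ univ) ^ (1 / 10 : ℝ) * (∫⁻ x, f x ∂μ) ^ (9 / 10 : ℝ) := by
  have hpq : (10 / 9 : ℝ).HolderConjugate 10 :=
    Real.holderConjugate_iff.2 ⟨by norm_num, by norm_num⟩
  have key := ENNReal.lintegral_mul_le_Lp_mul_Lq μ hpq (hf.pow_const (9 / 10 : ℝ))
    (g := fun _ => 1) aemeasurable_const
  have h2 : ∀ x, (f x ^ (9 / 10 : ℝ)) ^ (10 / 9 : ℝ) = f x := fun x => by
    rw [← ENNReal.rpow_mul, show (9 / 10 : ℝ) * (10 / 9) = 1 by norm_num, ENNReal.rpow_one]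
  simp only [Pi.mul_apply, mul_one, h2, ENNReal.one_rpow, lintegral_const, one_mul] at key
  rw [show (1 : ℝ) / (10 / 9) = 9 / 10 by norm_num] at key
  rw [mul_comm]
  exact key

/-! ### The weight `|x'|^{-12/7}` -/

/-- The planar weight `|w|^{-12/7}` in `ℝ≥0∞` form agrees with the real power off the origin.
[folklore] -/
theorem inv_ofReal_norm_rpow_eq {w : ℝ²} (hw : w ≠ 0) :
    (ENNReal.ofReal ‖w‖)⁻¹ ^ (12 / 7 : ℝ) = ENNReal.ofReal (‖w‖ ^ (-(12 / 7) : ℝ)) := by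
  have hn : 0 < ‖w‖ := norm_pos_iff.2 hw
  rw [← ENNReal.ofReal_inv_of_pos hn, ENNReal.ofReal_rpow_of_nonneg (inv_nonneg.2 hn.le)
    (by norm_num), Real.inv_rpow hn.le, ← Real.rpow_neg hn.le]

/-- `∫_{B₁ ⊂ ℝ²} |w|^{-12/7} dw < ∞` (`12/7 < 2`; polar coordinates, Mathlib's
`integrableOn_fun_norm_addHaar`). [folklore] -/
theorem lintegral_inv_norm_rpow_unitBall_lt_top :
    ∫⁻ w in ball (0 : ℝ²) 1, (ENNReal.ofReal ‖w‖)⁻¹ ^ (12 / 7 : ℝ) < ∞ := by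
  have hint : IntegrableOn (fun w : ℝ² => ‖w‖ ^ (-(12 / 7) : ℝ)) (ball (0 : ℝ²) 1) volume := by
    rw [integrableOn_fun_norm_addHaar volume (f := fun y : ℝ => y ^ (-(12 / 7) : ℝ)),
      finrank_euclideanSpace, Fintype.card_fin]
    simp only [Nat.add_one_sub_one, pow_one, smul_eq_mul]
    have h : IntegrableOn (fun y : ℝ => y ^ (-(5 / 7) : ℝ)) (Ioo (0 : ℝ) 1) volume := by
      have := intervalIntegral.intervalIntegrable_rpow' (a := 0) (b := 1) (r := -(5 / 7))
        (by norm_num)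
      rwa [intervalIntegrable_iff_integrableOn_Ioo_of_le zero_le_one] at this
    refine h.congr_fun (fun y hy => ?_) measurableSet_Ioo
    show y ^ (-(5 / 7) : ℝ) = y * y ^ (-(12 / 7) : ℝ)
    rw [show (-(5 / 7) : ℝ) = 1 + -(12 / 7) by norm_num, Real.rpow_add hy.1, Real.rpow_one]
  have hae : ∀ᵐ w ∂(volume.restrict (ball (0 : ℝ²) 1)),
      (ENNReal.ofReal ‖w‖)⁻¹ ^ (12 / 7 : ℝ) = ‖(‖w‖ ^ (-(12 / 7) : ℝ))‖ₑ := by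
    have h0 : ∀ᵐ w ∂(volume.restrict (ball (0 : ℝ²) 1)), w ≠ (0 : ℝ²) := by
      have : (volume.restrict (ball (0 : ℝ²) 1)) {0} = 0 :=
        le_antisymm ((Measure.restrict_apply_le _ _).trans (by rw [measure_singleton])) bot_le
      exact measure_eq_zero_iff_ae_notMem.1 this
    filter_upwards [h0] with w hw
    rw [inv_ofReal_norm_rpow_eq hw, Real.enorm_eq_ofReal (Real.rpow_nonneg (norm_nonneg _) _)]
  rw [lintegral_congr_ae hae]
  exact hint.2

/-- Scaling of the planar weight integral: `∫_{B_ρ} |w|^{-12/7} dw = ρ^{2/7} ∫_{B₁} |w|^{-12/7} dw`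
(substitute `w = ρ v`, `dw = ρ² dv`). [folklore] -/
theorem lintegral_inv_norm_rpow_ball {ρ : ℝ} (hρ : 0 < ρ) :
    ∫⁻ w in ball (0 : ℝ²) ρ, (ENNReal.ofReal ‖w‖)⁻¹ ^ (12 / 7 : ℝ) =
      ENNReal.ofReal ρ ^ (2 / 7 : ℝ) *
        ∫⁻ w in ball (0 : ℝ²) 1, (ENNReal.ofReal ‖w‖)⁻¹ ^ (12 / 7 : ℝ) := by
  set h : ℝ² → ℝ≥0∞ := fun w => (ENNReal.ofReal ‖w‖)⁻¹ ^ (12 / 7 : ℝ) with hh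
  -- the homothety `v ↦ ρ v`
  have hsub : ∀ F : ℝ² → ℝ≥0∞, ∫⁻ v, F (ρ • v) = ENNReal.ofReal |(ρ ^ 2)⁻¹| * ∫⁻ w, F w := by
    intro F
    calc ∫⁻ v, F (ρ • v) = ∫⁻ w, F w ∂(Measure.map (fun v : ℝ² => ρ • v) volume) :=
          (lintegral_map_equiv F
            (Homeomorph.smul (isUnit_iff_ne_zero.2 hρ.ne').unit).toMeasurableEquiv).symm
      _ = ENNReal.ofReal |(ρ ^ 2)⁻¹| * ∫⁻ w, F w := by
          rw [Measure.map_addHaar_smul volume hρ.ne', lintegral_smul_measure, smul_eq_mul,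
            finrank_euclideanSpace, Fintype.card_fin]
  have hpre : ∀ v : ℝ², ρ • v ∈ ball (0 : ℝ²) ρ ↔ v ∈ ball (0 : ℝ²) 1 := fun v => by
    rw [mem_ball_zero_iff, mem_ball_zero_iff, norm_smul, Real.norm_eq_abs, abs_of_pos hρ]
    constructor
    · intro h1; nlinarith
    · intro h1; nlinarith
  have hρ0 : ENNReal.ofReal ρ ≠ 0 := (ENNReal.ofReal_pos.2 hρ).ne'
  have hval : ∀ v : ℝ², h (ρ • v) = (ENNReal.ofReal ρ)⁻¹ ^ (12 / 7 : ℝ) * h v := fun v => by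
    simp only [hh]
    rw [norm_smul, Real.norm_eq_abs, abs_of_pos hρ, ENNReal.ofReal_mul hρ.le,
      ENNReal.mul_inv (Or.inl hρ0) (Or.inl ENNReal.ofReal_ne_top),
      ENNReal.mul_rpow_of_nonneg _ _ (by norm_num)]
  have key := hsub ((ball (0 : ℝ²) ρ).indicator h)
  have hind : ∀ v : ℝ², (ball (0 : ℝ²) ρ).indicator h (ρ • v) =
      (ball (0 : ℝ²) 1).indicator (fun v => (ENNReal.ofReal ρ)⁻¹ ^ (12 / 7 : ℝ) * h v) v := by
    intro v
    by_cases hv : v ∈ ball (0 : ℝ²) 1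
    · rw [indicator_of_mem ((hpre v).2 hv), indicator_of_mem hv, hval]
    · rw [indicator_of_notMem (fun h' => hv ((hpre v).1 h')), indicator_of_notMem hv]
  simp_rw [hind] at key
  rw [lintegral_indicator measurableSet_ball, lintegral_indicator measurableSet_ball,
    lintegral_const_mul' _ _ (ENNReal.rpow_ne_top_of_nonneg (by norm_num)
      (ENNReal.inv_ne_top.2 hρ0))] at key
  -- `key : ρ^{-12/7} ∫_{B₁} h = |ρ⁻²| ∫_{B_ρ} h`
  have hρ2 : ENNReal.ofReal |(ρ ^ 2)⁻¹| = (ENNReal.ofReal ρ ^ 2)⁻¹ := by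
    rw [abs_of_pos (by positivity), ENNReal.ofReal_inv_of_pos (by positivity),
      ENNReal.ofReal_pow hρ.le]
  rw [hρ2] at key
  have h2t : ENNReal.ofReal ρ ^ 2 ≠ ∞ := ENNReal.pow_ne_top ENNReal.ofReal_ne_top
  have h20 : ENNReal.ofReal ρ ^ 2 ≠ 0 := pow_ne_zero _ hρ0
  calc ∫⁻ w in ball (0 : ℝ²) ρ, h w
      = ENNReal.ofReal ρ ^ 2 * ((ENNReal.ofReal ρ ^ 2)⁻¹ * ∫⁻ w in ball (0 : ℝ²) ρ, h w) := by
        rw [← mul_assoc, ENNReal.mul_inv_cancel h20 h2t, one_mul]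
    _ = ENNReal.ofReal ρ ^ 2 * ((ENNReal.ofReal ρ)⁻¹ ^ (12 / 7 : ℝ) *
          ∫⁻ w in ball (0 : ℝ²) 1, h w) := by rw [key]
    _ = ENNReal.ofReal ρ ^ (2 / 7 : ℝ) * ∫⁻ w in ball (0 : ℝ²) 1, h w := by
        rw [← mul_assoc]
        congr 1
        rw [ENNReal.inv_rpow, ← ENNReal.rpow_neg, show ENNReal.ofReal ρ ^ 2 =
          ENNReal.ofReal ρ ^ (2 : ℝ) by rw [← ENNReal.rpow_natCast]; norm_num,
          ← ENNReal.rpow_add _ _ hρ0 ENNReal.ofReal_ne_top]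
        norm_num

/-- The spatial cylinder `𝒞(b e₃, ρ)` in the cylindrical splitting `x ↦ (x₃, x')` is the product
`]b - ρ, b + ρ[ × B_ρ(0) ⊆ ℝ × ℝ²`. [folklore] -/
theorem spaceCyl_axis_eq_preimage (b ρ : ℝ) :
    spaceCyl (b • eZ) ρ = cylSplit ⁻¹' (Ioo (b - ρ) (b + ρ) ×ˢ ball (0 : ℝ²) ρ) := by
  ext x
  rw [mem_spaceCyl, cylRadius_sub_smul_eZ, mem_preimage, mem_prod, mem_Ioo, mem_ball_zero_iff,
    ← cylRadius_eq_norm_cylSplit_snd, cylSplit_apply_fst]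
  simp only [PiLp.smul_apply, eZ_apply_two, smul_eq_mul, mul_one]
  rw [abs_sub_lt_iff]
  constructor
  · rintro ⟨h1, h2, h3⟩; exact ⟨⟨by linarith, by linarith⟩, h1⟩
  · rintro ⟨⟨h2, h3⟩, h1⟩; exact ⟨h1, by linarith, by linarith⟩

/-- **The weight integral over `𝒞(b e₃, ρ)`**:
`∫_{𝒞(b e₃, ρ)} |x'|^{-12/7} dx = 2ρ · ρ^{2/7} ∫_{B₁ ⊂ ℝ²} |w|^{-12/7} dw` (Fubini in `(x₃, x')`
and the planar scaling) — this is the quantity `M_{s,l}` of (as2) for the weight in the case at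
hand. [folklore] -/
theorem lintegral_inv_cylRadius_rpow_spaceCyl (b : ℝ) {ρ : ℝ} (hρ : 0 < ρ) :
    ∫⁻ x in spaceCyl (b • eZ) ρ, (ENNReal.ofReal (cylRadius x))⁻¹ ^ (12 / 7 : ℝ) =
      ENNReal.ofReal (2 * ρ) * (ENNReal.ofReal ρ ^ (2 / 7 : ℝ) *
        ∫⁻ w in ball (0 : ℝ²) 1, (ENNReal.ofReal ‖w‖)⁻¹ ^ (12 / 7 : ℝ)) := by
  set g : ℝ × ℝ² → ℝ≥0∞ := fun p => (ENNReal.ofReal ‖p.2‖)⁻¹ ^ (12 / 7 : ℝ) with hg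
  have hgm : Measurable g := by
    simp only [hg]
    exact ((continuous_norm.measurable.comp measurable_snd).ennreal_ofReal.inv).pow_const _
  have e1 : ∫⁻ x in spaceCyl (b • eZ) ρ, (ENNReal.ofReal (cylRadius x))⁻¹ ^ (12 / 7 : ℝ) =
      ∫⁻ x in cylSplit ⁻¹' (Ioo (b - ρ) (b + ρ) ×ˢ ball (0 : ℝ²) ρ), g (cylSplit x) := by
    rw [spaceCyl_axis_eq_preimage]
    refine lintegral_congr fun x => ?_
    rw [hg, cylRadius_eq_norm_cylSplit_snd]
  rw [e1, measurePreserving_cylSplit.setLIntegral_comp_preimage_emb cylSplit.measurableEmbedding,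
    Measure.volume_eq_prod, ← Measure.prod_restrict,
    lintegral_prod _ (hgm.aemeasurable)]
  simp only [hg]
  rw [lintegral_const, Measure.restrict_apply_univ, Real.volume_Ioo,
    show b + ρ - (b - ρ) = 2 * ρ by ring, lintegral_inv_norm_rpow_ball hρ, mul_comm]

/-! ### Operator norm versus Frobenius norm; the Sobolev inequality on slices -/

/-- `‖L‖² ≤ |L|²` for the Frobenius density `|L|² = ∑ᵢ ‖L eᵢ‖²` (Cauchy–Schwarz in an
orthonormal expansion; the tree's `opNorm_sq_le_frobeniusNormSq_fin3`, restated to keep the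
imports light). [folklore] -/
theorem opNorm_sq_le_frobeniusNormSq' (L : ℝ³ →L[ℝ] ℝ³) : ‖L‖ ^ 2 ≤ frobeniusNormSq L := by
  set b := stdOrthonormalBasis ℝ ℝ³
  have hfrob : frobeniusNormSq L = ∑ i, ‖L (b i)‖ ^ 2 := rfl
  have hle : ‖L‖ ≤ Real.sqrt (frobeniusNormSq L) := by
    refine ContinuousLinearMap.opNorm_le_bound _ (Real.sqrt_nonneg _) fun v => ?_
    have hv : L v = ∑ i, ⟪b i, v⟫ • L (b i) := by
      conv_lhs => rw [← b.sum_repr' v]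
      simp [map_sum, map_smul]
    calc ‖L v‖ = ‖∑ i, ⟪b i, v⟫ • L (b i)‖ := by rw [hv]
      _ ≤ ∑ i, ‖⟪b i, v⟫ • L (b i)‖ := norm_sum_le _ _
      _ = ∑ i, |⟪b i, v⟫| * ‖L (b i)‖ := by simp [norm_smul]
      _ ≤ Real.sqrt (∑ i, |⟪b i, v⟫| ^ 2) * Real.sqrt (∑ i, ‖L (b i)‖ ^ 2) :=
          Real.sum_mul_le_sqrt_mul_sqrt _ _ _
      _ = Real.sqrt (frobeniusNormSq L) * ‖v‖ := by
          rw [hfrob, mul_comm]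
          congr 1
          simp_rw [sq_abs]
          rw [b.sum_sq_inner_right, Real.sqrt_sq (norm_nonneg _)]
  calc ‖L‖ ^ 2 ≤ (Real.sqrt (frobeniusNormSq L)) ^ 2 := pow_le_pow_left₀ (norm_nonneg _) hle 2
    _ = frobeniusNormSq L := Real.sq_sqrt (frobeniusNormSq_nonneg _)

/-- `‖L‖ₑ² ≤ |L|²` in `ℝ≥0∞`. [folklore] -/
theorem enorm_sq_le_ofReal_frobeniusNormSq (L : ℝ³ →L[ℝ] ℝ³) :
    ‖L‖ₑ ^ 2 ≤ ENNReal.ofReal (frobeniusNormSq L) := by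
  rw [← ofReal_norm, ← ENNReal.ofReal_pow (norm_nonneg _)]
  exact ENNReal.ofReal_le_ofReal (opNorm_sq_le_frobeniusNormSq' L)

/-- `‖g‖_{L²(μ)} ≤ (∫ |g|² dμ)^{1/2}` for the Frobenius density. [folklore] -/
theorem eLpNorm_two_le_lintegral_frob_rpow (μ : Measure ℝ³) (g : ℝ³ → ℝ³ →L[ℝ] ℝ³) :
    eLpNorm g 2 μ ≤ (∫⁻ x, ENNReal.ofReal (frobeniusNormSq (g x)) ∂μ) ^ (1 / 2 : ℝ) := by
  rw [eLpNorm_eq_lintegral_rpow_enorm_toReal two_ne_zero ENNReal.ofNat_ne_top, ENNReal.toReal_ofNat]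
  gcongr with x
  rw [show (2 : ℝ) = ((2 : ℕ) : ℝ) by norm_num, ENNReal.rpow_natCast]
  exact enorm_sq_le_ofReal_frobeniusNormSq _

/-- `‖f‖_{L²(μ)} = (∫ ‖f‖ₑ² dμ)^{1/2}`. [folklore] -/
theorem eLpNorm_two_eq_lintegral_sq_rpow (μ : Measure ℝ³) (f : ℝ³ → ℝ³) :
    eLpNorm f 2 μ = (∫⁻ x, ‖f x‖ₑ ^ 2 ∂μ) ^ (1 / 2 : ℝ) := by
  rw [eLpNorm_eq_lintegral_rpow_enorm_toReal two_ne_zero ENNReal.ofNat_ne_top, ENNReal.toReal_ofNat]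
  congr 1
  refine lintegral_congr fun x => ?_
  rw [show (2 : ℝ) = ((2 : ℕ) : ℝ) by norm_num, ENNReal.rpow_natCast]

/-- **Sobolev on balls, in the form consumed below.** There is an absolute `C_S` such that for
every ball `B = B(x₀, ρ)`, every `f ∈ L²(B)` with weak derivative `g`, `∫_B |g|² < ∞`:
`(∫_B ‖f‖⁶)^{3/10} ≤ C_S (ρ⁻² ∫_B ‖f‖² + ∫_B |g|²)^{9/10}`, i.e. `‖f‖_{L⁶(B)}^{9/5} ≤
C_S (ρ⁻² ‖f‖²_{L²} + ‖g‖²_{L²})^{9/10}` (the scale-invariant Sobolev inequality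
`‖f‖_{L⁶(B)} ≤ C (ρ⁻¹ ‖f‖_{L²(B)} + ‖g‖_{L²(B)})` of the tree's
`FunctionSpaces.exists_eLpNorm_le_ball`, raised to the power `9/5`): the Gagliardo–Nirenberg
ingredient of (as2). [folklore] -/
theorem exists_sobolev_slice_bound :
    ∃ CS : ℝ≥0, ∀ (x₀ : ℝ³) (ρ : ℝ), 0 < ρ → ∀ (f : ℝ³ → ℝ³) (g : ℝ³ → ℝ³ →L[ℝ] ℝ³),
      FunctionSpaces.HasWeakFDerivOn (⟨ball x₀ ρ, isOpen_ball⟩ : Opens ℝ³) volume f g →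
      (∫⁻ x in ball x₀ ρ, ‖f x‖ₑ ^ 2) ≠ ∞ →
      (∫⁻ x in ball x₀ ρ, ENNReal.ofReal (frobeniusNormSq (g x))) ≠ ∞ →
      (∫⁻ x in ball x₀ ρ, ‖f x‖ₑ ^ (6 : ℝ)) ^ (3 / 10 : ℝ) ≤
        CS * ((ENNReal.ofReal ρ)⁻¹ ^ 2 * (∫⁻ x in ball x₀ ρ, ‖f x‖ₑ ^ 2) +
          ∫⁻ x in ball x₀ ρ, ENNReal.ofReal (frobeniusNormSq (g x))) ^ (9 / 10 : ℝ) := by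
  obtain ⟨C, hC⟩ := FunctionSpaces.exists_eLpNorm_le_ball (E := ℝ³) (F := ℝ³) (p := 2) (p' := 6)
    one_le_two (by rw [finrank_euclideanSpace_fin]; norm_num)
    (by rw [finrank_euclideanSpace_fin]; norm_num)
  refine ⟨(2 * C) ^ (9 / 5 : ℝ), fun x₀ ρ hρ f g hw hf2 hg2 => ?_⟩
  set B : Set ℝ³ := ball x₀ ρ with hB
  set a : ℝ≥0∞ := ∫⁻ x in B, ‖f x‖ₑ ^ 2 with ha
  set e : ℝ≥0∞ := ∫⁻ x in B, ENNReal.ofReal (frobeniusNormSq (g x)) with he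
  -- `f ∈ W^{1,2}(B)`
  have hfm : AEStronglyMeasurable f (volume.restrict B) := hw.locallyIntegrableOn.aestronglyMeasurable
  have hL2 : eLpNorm f 2 (volume.restrict B) = a ^ (1 / 2 : ℝ) := eLpNorm_two_eq_lintegral_sq_rpow _ _
  have hfL : MemLp f 2 (volume.restrict B) := by
    refine ⟨hfm, ?_⟩
    rw [hL2]
    exact ENNReal.rpow_lt_top_of_nonneg (by norm_num) hf2
  have hgm : AEStronglyMeasurable g (volume.restrict B) :=
    hw.locallyIntegrableOn_deriv.aestronglyMeasurable
  have hg2' := eLpNorm_two_le_lintegral_frob_rpow (volume.restrict B) g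
  have hgL : MemLp g 2 (volume.restrict B) :=
    ⟨hgm, hg2'.trans_lt (ENNReal.rpow_lt_top_of_nonneg (by norm_num) hg2)⟩
  have hsob : FunctionSpaces.MemSobolevDomain 1 ((2 : ℝ≥0) : ℝ≥0∞)
      (⟨ball x₀ ρ, isOpen_ball⟩ : Opens ℝ³) volume f := by
    refine FunctionSpaces.memSobolevDomain_succ_iff.2 ⟨by exact_mod_cast hfL, g, hw, fun v => ?_⟩
    rw [FunctionSpaces.memSobolevDomain_zero_iff]
    exact_mod_cast (ContinuousLinearMap.apply ℝ ℝ³ v).comp_memLp' hgL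
  have hS := hC x₀ ρ hρ f g hsob hw
  have hS' : eLpNorm f 6 (volume.restrict B) ≤
      C * ((ENNReal.ofReal ρ)⁻¹ * eLpNorm f 2 (volume.restrict B) + eLpNorm g 2 (volume.restrict B)) := by
    exact_mod_cast hS
  -- `ρ⁻¹ a^{1/2} + e^{1/2} ≤ 2 (ρ⁻² a + e)^{1/2}`
  set X : ℝ≥0∞ := (ENNReal.ofReal ρ)⁻¹ ^ 2 * a + e with hX
  have h1 : (ENNReal.ofReal ρ)⁻¹ * a ^ (1 / 2 : ℝ) ≤ X ^ (1 / 2 : ℝ) := by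
    have : (ENNReal.ofReal ρ)⁻¹ * a ^ (1 / 2 : ℝ) = ((ENNReal.ofReal ρ)⁻¹ ^ 2 * a) ^ (1 / 2 : ℝ) := by
      rw [ENNReal.mul_rpow_of_nonneg _ _ (by norm_num), ← ENNReal.rpow_natCast,
        ← ENNReal.rpow_mul]
      norm_num
    rw [this]
    exact ENNReal.rpow_le_rpow le_self_add (by norm_num)
  have h2 : eLpNorm g 2 (volume.restrict B) ≤ X ^ (1 / 2 : ℝ) :=
    hg2'.trans (ENNReal.rpow_le_rpow le_add_self (by norm_num))
  have hS2 : eLpNorm f 6 (volume.restrict B) ≤ ((2 * C : ℝ≥0) : ℝ≥0∞) * X ^ (1 / 2 : ℝ) := by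
    refine hS'.trans ?_
    rw [hL2]
    calc (C : ℝ≥0∞) * ((ENNReal.ofReal ρ)⁻¹ * a ^ (1 / 2 : ℝ) + eLpNorm g 2 (volume.restrict B))
        ≤ C * (X ^ (1 / 2 : ℝ) + X ^ (1 / 2 : ℝ)) := by gcongr
      _ = ((2 * C : ℝ≥0) : ℝ≥0∞) * X ^ (1 / 2 : ℝ) := by push_cast; ring
  -- `(∫ ‖f‖⁶)^{3/10} = ‖f‖_{L⁶}^{9/5}`
  have hL6 : (∫⁻ x in B, ‖f x‖ₑ ^ (6 : ℝ)) ^ (3 / 10 : ℝ) =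
      eLpNorm f 6 (volume.restrict B) ^ (9 / 5 : ℝ) := by
    rw [eLpNorm_eq_lintegral_rpow_enorm_toReal (by norm_num) ENNReal.ofNat_ne_top,
      ENNReal.toReal_ofNat, ← ENNReal.rpow_mul]
    norm_num
  rw [hL6]
  calc eLpNorm f 6 (volume.restrict B) ^ (9 / 5 : ℝ)
      ≤ (((2 * C : ℝ≥0) : ℝ≥0∞) * X ^ (1 / 2 : ℝ)) ^ (9 / 5 : ℝ) := by gcongr
    _ = (((2 * C) ^ (9 / 5 : ℝ) : ℝ≥0) : ℝ≥0∞) * X ^ (9 / 10 : ℝ) := by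
        rw [ENNReal.mul_rpow_of_nonneg _ _ (by norm_num), ← ENNReal.rpow_mul,
          ENNReal.coe_rpow_of_nonneg _ (by norm_num)]
        norm_num

/-! ### Almost-everywhere bookkeeping -/

/-- An a.e. statement on a product set `I × B ⊆ ℝ × ℝ³` holds for a.e. `t ∈ I` and a.e. `x ∈ B`
(Fubini for null sets). [folklore] -/
theorem ae_ae_of_ae_restrict_prod {I : Set ℝ} {B : Set ℝ³} {P : ℝ × ℝ³ → Prop}
    (h : ∀ᵐ z ∂(volume.restrict (I ×ˢ B)), P z) :
    ∀ᵐ t ∂(volume.restrict I), ∀ᵐ x ∂(volume.restrict B), P (t, x) := by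
  rw [Measure.volume_eq_prod, ← Measure.prod_restrict] at h
  exact Measure.ae_ae_of_ae_prod h

/-- The slices of `A`: for a.e. `t ∈ ]t₀ - ρ², t₀[`, `∫_{𝒞(x₀, ρ)} |u(t)|² ≤ ρ A(z₀, ρ; u)`
(`A` is an essential supremum). [folklore] -/
theorem ae_lintegral_sq_le_energyA (z₀ : ℝ × ℝ³) {ρ : ℝ} (hρ : 0 < ρ) (u : ℝ → ℝ³ → ℝ³) :
    ∀ᵐ t ∂(volume.restrict (Ioo (z₀.1 - ρ ^ 2) z₀.1)),
      ∫⁻ x in spaceCyl z₀.2 ρ, ‖u t x‖ₑ ^ 2 ≤ ENNReal.ofReal ρ * energyA z₀ ρ u := by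
  have h := ENNReal.ae_le_essSup (μ := volume.restrict (Ioo (z₀.1 - ρ ^ 2) z₀.1))
    (fun t => (ENNReal.ofReal ρ)⁻¹ * ∫⁻ x in spaceCyl z₀.2 ρ, ‖u t x‖ₑ ^ 2)
  filter_upwards [h] with t ht
  have h0 : ENNReal.ofReal ρ ≠ 0 := (ENNReal.ofReal_pos.2 hρ).ne'
  calc ∫⁻ x in spaceCyl z₀.2 ρ, ‖u t x‖ₑ ^ 2
      = ENNReal.ofReal ρ * ((ENNReal.ofReal ρ)⁻¹ * ∫⁻ x in spaceCyl z₀.2 ρ, ‖u t x‖ₑ ^ 2) := by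
        rw [← mul_assoc, ENNReal.mul_inv_cancel h0 ENNReal.ofReal_ne_top, one_mul]
    _ ≤ ENNReal.ofReal ρ * energyA z₀ ρ u := mul_le_mul_right ht _

/-- `∫_{Q(z₀, ρ)} |∇u|² = ρ E(z₀, ρ)` for `ρ > 0`. [folklore] -/
theorem setLIntegral_eq_mul_dissipationE (z₀ : ℝ × ℝ³) {ρ : ℝ} (hρ : 0 < ρ)
    (G : ℝ → ℝ³ → ℝ³ →L[ℝ] ℝ³) :
    ∫⁻ z in parCyl z₀ ρ, ENNReal.ofReal (frobeniusNormSq (G z.1 z.2)) =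
      ENNReal.ofReal ρ * dissipationE z₀ ρ G := by
  rw [dissipationE, ← mul_assoc, ENNReal.mul_inv_cancel (by positivity) (by simp), one_mul]

/-! ### Scalar bookkeeping -/

/-- Scalar bookkeeping for the powers of the radius in the weighted interpolation estimate:
`Kp (2V (2R)^{9/7})^{7/10} C_S (R²)^{1/10} (2R)^{9/10} = ((2V)^{7/10} 2^{9/5} C_S) Kp R²`
(the exponents of (as2)–(as3) add up to scale invariance). [folklore] -/
theorem radius_powers_identity {R : ℝ≥0∞} (hR : R ≠ 0) (hR' : R ≠ ∞) (V CS Kp : ℝ≥0∞) :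
    Kp * (2 * V * (2 * R) ^ (9 / 7 : ℝ)) ^ (7 / 10 : ℝ) * CS * (R ^ 2) ^ (1 / 10 : ℝ) *
        (2 * R) ^ (9 / 10 : ℝ) =
      ((2 * V) ^ (7 / 10 : ℝ) * (2 : ℝ≥0∞) ^ (9 / 5 : ℝ) * CS) * Kp * R ^ 2 := by
  have e1 : (2 * V * (2 * R) ^ (9 / 7 : ℝ)) ^ (7 / 10 : ℝ) =
      (2 * V) ^ (7 / 10 : ℝ) * ((2 : ℝ≥0∞) ^ (9 / 10 : ℝ) * R ^ (9 / 10 : ℝ)) := by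
    rw [ENNReal.mul_rpow_of_nonneg _ _ (by norm_num : (0 : ℝ) ≤ 7 / 10), ← ENNReal.rpow_mul,
      show (9 / 7 : ℝ) * (7 / 10) = 9 / 10 by norm_num,
      ENNReal.mul_rpow_of_nonneg _ _ (by norm_num : (0 : ℝ) ≤ 9 / 10)]
  have e2 : (R ^ 2) ^ (1 / 10 : ℝ) = R ^ (1 / 5 : ℝ) := by
    rw [show R ^ 2 = R ^ (2 : ℝ) by rw [← ENNReal.rpow_natCast]; norm_num, ← ENNReal.rpow_mul]
    norm_num
  have e3 : (2 * R) ^ (9 / 10 : ℝ) = (2 : ℝ≥0∞) ^ (9 / 10 : ℝ) * R ^ (9 / 10 : ℝ) :=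
    ENNReal.mul_rpow_of_nonneg _ _ (by norm_num)
  have e4 : R ^ (9 / 10 : ℝ) * R ^ (1 / 5 : ℝ) * R ^ (9 / 10 : ℝ) = R ^ 2 := by
    rw [← ENNReal.rpow_add _ _ hR hR', ← ENNReal.rpow_add _ _ hR hR',
      show (9 / 10 : ℝ) + 1 / 5 + 9 / 10 = ((2 : ℕ) : ℝ) by norm_num, ENNReal.rpow_natCast]
  have e5 : (2 : ℝ≥0∞) ^ (9 / 10 : ℝ) * (2 : ℝ≥0∞) ^ (9 / 10 : ℝ) = (2 : ℝ≥0∞) ^ (9 / 5 : ℝ) := by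
    rw [← ENNReal.rpow_add _ _ two_ne_zero ENNReal.ofNat_ne_top]; norm_num
  rw [e1, e2, e3]
  calc Kp * ((2 * V) ^ (7 / 10 : ℝ) * ((2 : ℝ≥0∞) ^ (9 / 10 : ℝ) * R ^ (9 / 10 : ℝ))) * CS *
        R ^ (1 / 5 : ℝ) * ((2 : ℝ≥0∞) ^ (9 / 10 : ℝ) * R ^ (9 / 10 : ℝ))
      = ((2 * V) ^ (7 / 10 : ℝ) * ((2 : ℝ≥0∞) ^ (9 / 10 : ℝ) * (2 : ℝ≥0∞) ^ (9 / 10 : ℝ)) * CS) *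
          Kp * (R ^ (9 / 10 : ℝ) * R ^ (1 / 5 : ℝ) * R ^ (9 / 10 : ℝ)) := by ring
    _ = _ := by rw [e4, e5]

/-- `ρ⁻² · (r² ρ) ≤ ρ` for `ρ = 2r` (in `ℝ≥0∞`). [folklore] -/
theorem inv_sq_mul_le {r : ℝ} (hr : 0 < r) :
    (ENNReal.ofReal (2 * r))⁻¹ ^ 2 * (ENNReal.ofReal (r ^ 2) * ENNReal.ofReal (2 * r)) ≤
      ENNReal.ofReal (2 * r) := by
  have h0 : ENNReal.ofReal (2 * r) ≠ 0 := (ENNReal.ofReal_pos.2 (by positivity)).ne'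
  have hle : ENNReal.ofReal (r ^ 2) ≤ ENNReal.ofReal (2 * r) ^ 2 := by
    rw [← ENNReal.ofReal_pow (by positivity)]
    exact ENNReal.ofReal_le_ofReal (by nlinarith)
  calc (ENNReal.ofReal (2 * r))⁻¹ ^ 2 * (ENNReal.ofReal (r ^ 2) * ENNReal.ofReal (2 * r))
      ≤ (ENNReal.ofReal (2 * r))⁻¹ ^ 2 * (ENNReal.ofReal (2 * r) ^ 2 * ENNReal.ofReal (2 * r)) := by
        gcongr
    _ = ENNReal.ofReal (2 * r) := by
        rw [← mul_assoc, ← ENNReal.inv_pow, ENNReal.inv_mul_cancel (pow_ne_zero _ h0)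
          (ENNReal.pow_ne_top ENNReal.ofReal_ne_top), one_mul]

/-! ### The main estimate -/

/-- **Seregin–Šverák 2009, the cubic functional under the axis decay (r4)** (the case
"`s = s₁`, `l = l₁` only" of the proof of Lemma 3.6, arXiv p. 10, i.e. the display (as8) of the
proof of Lemma 3.5, arXiv p. 9, for the whole field: `C(z_b, r; v)` is bounded by a power of the
constant in `|x'||v| ≤ C` times a power `< 1` of `E + A`). There is an absolute `K₁` such that
for every field `u : Q → ℝ³` with a weak spatial gradient `G` on `Q = 𝒞 × ]-1, 0[` (Remark 3.4)
satisfying `|x'| ‖u(t, x)‖ ≤ C` a.e. on `Q` (hypothesis (r4) of Thm. 3.2), all `|b| ≤ 1/4` and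
`0 < r ≤ 3/8`,
`C((0, b e₃), r; u) ≤ K₁ (C + 1)^{6/5} (A((0, b e₃), 2r; u) + E((0, b e₃), 2r; G))^{9/10}`.
See the module docstring for the proof (weighted Hölder, Sobolev on `B(b e₃, 2r)` slice-wise,
Hölder in time). [cite: SereginSverak2009, proof of Lemma 3.6 via (as8) (arXiv pp. 9–10)] -/
theorem exists_cubicC_le_of_axisDecay :
    ∃ K₁ : ℝ≥0, ∀ (u : ℝ → ℝ³ → ℝ³) (G : ℝ → ℝ³ → ℝ³ →L[ℝ] ℝ³) (C : ℝ≥0) (b r : ℝ),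
      HasWeakSpatialGradientOn (parCylOpens 0 1) u G →
      (∀ᵐ z ∂(volume.restrict (parCyl 0 1)), cylRadius z.2 * ‖u z.1 z.2‖ ≤ C) →
      |b| ≤ 1 / 4 → 0 < r → r ≤ 3 / 8 →
      cubicC ((0 : ℝ), b • eZ) r u ≤ K₁ * ((C : ℝ≥0∞) + 1) ^ (6 / 5 : ℝ) *
        (energyA ((0 : ℝ), b • eZ) (2 * r) u + dissipationE ((0 : ℝ), b • eZ) (2 * r) G) ^
          (9 / 10 : ℝ) := by
  obtain ⟨CS, hCS⟩ := exists_sobolev_slice_bound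
  set V₁ : ℝ≥0∞ := ∫⁻ w in ball (0 : ℝ²) 1, (ENNReal.ofReal ‖w‖)⁻¹ ^ (12 / 7 : ℝ) with hV₁
  have hV₁t : V₁ ≠ ∞ := lintegral_inv_norm_rpow_unitBall_lt_top.ne
  -- the constant
  set K₀ : ℝ≥0∞ := (2 * V₁) ^ (7 / 10 : ℝ) * (2 : ℝ≥0∞) ^ (9 / 5 : ℝ) * CS with hK₀
  have hK₀t : K₀ ≠ ∞ := by
    refine ENNReal.mul_ne_top (ENNReal.mul_ne_top ?_ ?_) ENNReal.coe_ne_top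
    · exact ENNReal.rpow_ne_top_of_nonneg (by norm_num) (ENNReal.mul_ne_top (by simp) hV₁t)
    · exact ENNReal.rpow_ne_top_of_nonneg (by norm_num) (by simp)
  refine ⟨K₀.toNNReal + 1, fun u G C b r hG hr4 hb hr hr38 => ?_⟩
  have hK₁ : ((K₀.toNNReal + 1 : ℝ≥0) : ℝ≥0∞) = K₀ + 1 := by
    push_cast; rw [ENNReal.coe_toNNReal hK₀t]
  rw [hK₁]
  -- notation
  set z : ℝ × ℝ³ := ((0 : ℝ), b • eZ) with hz
  set ρ : ℝ := 2 * r with hρ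
  have hρ0 : 0 < ρ := by positivity
  have hρ0' : ENNReal.ofReal ρ ≠ 0 := (ENNReal.ofReal_pos.2 hρ0).ne'
  set A := energyA z ρ u with hA
  set E := dissipationE z ρ G with hE
  set K : ℝ≥0∞ := (C : ℝ≥0∞) + 1 with hK
  have hK0 : K ≠ 0 := by simp [hK]
  have hKt : K ≠ ∞ := by simp [hK]
  -- trivial when `A + E = ∞`
  rcases eq_or_ne (A + E) ∞ with hAE | hAE
  · rw [hAE, ENNReal.top_rpow_of_pos (by norm_num), ENNReal.mul_top]
    · exact le_top
    · exact mul_ne_zero (by simp) (ENNReal.rpow_pos (pos_iff_ne_zero.2 hK0) hKt).ne'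
  have hAt : A ≠ ∞ := ne_top_of_le_ne_top hAE le_self_add
  have hEt : E ≠ ∞ := ne_top_of_le_ne_top hAE le_add_self
  -- sets
  set I : Set ℝ := Ioo (-r ^ 2) 0 with hI
  set S : Set ℝ³ := spaceCyl (b • eZ) r with hS
  set B : Set ℝ³ := ball (b • eZ) ρ with hB
  have hzI : Ioo (z.1 - r ^ 2) z.1 = I := by
    show Ioo ((0 : ℝ) - r ^ 2) 0 = I
    rw [zero_sub]
  have hQ : parCyl z r = I ×ˢ S := by rw [parCyl_eq_prod, hzI]
  have hSB : S ⊆ B := by rw [hS, hB, hρ]; exact spaceCyl_subset_ball _ _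
  have hBS : B ⊆ spaceCyl (b • eZ) ρ := fun x hx => mem_spaceCyl_of_norm_lt (mem_ball_iff_norm.1 hx)
  have hIρ : I ⊆ Ioo (z.1 - ρ ^ 2) z.1 := by
    intro t ht
    show t ∈ Ioo ((0 : ℝ) - ρ ^ 2) 0
    refine ⟨?_, ht.2⟩
    have := ht.1
    rw [hρ]
    nlinarith [hr]
  have hIB : I ×ˢ B ⊆ parCyl z ρ := by
    rw [parCyl_eq_prod]; exact prod_mono hIρ hBS
  have hQρ : parCyl z ρ ⊆ parCyl 0 1 :=
    parCyl_axis_subset hρ0.le (by rw [hρ]; linarith [abs_nonneg b])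
  have hIB1 : I ×ˢ B ⊆ parCyl 0 1 := hIB.trans hQρ
  -- measurability
  have hum : AEStronglyMeasurable (uncurry u) (volume.restrict (I ×ˢ B)) :=
    (hG.locallyIntegrableOn.mono_set hIB1).aestronglyMeasurable
  have hGm : AEStronglyMeasurable (uncurry G) (volume.restrict (I ×ˢ B)) :=
    (hG.locallyIntegrableOn_grad.mono_set hIB1).aestronglyMeasurable
  have hprod : (volume.restrict (I ×ˢ B) : Measure (ℝ × ℝ³)) =
      (volume.restrict I).prod (volume.restrict B) := by
    rw [Measure.volume_eq_prod, Measure.prod_restrict]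
  set a : ℝ → ℝ≥0∞ := fun t => ∫⁻ x in B, ‖u t x‖ₑ ^ 2 with ha
  set e : ℝ → ℝ≥0∞ := fun t => ∫⁻ x in B, ENNReal.ofReal (frobeniusNormSq (G t x)) with he
  have hum2 : AEMeasurable (fun q : ℝ × ℝ³ => ‖u q.1 q.2‖ₑ ^ 2)
      ((volume.restrict I).prod (volume.restrict B)) := by
    rw [← hprod]; exact hum.enorm.pow_const 2
  have hGm2 : AEMeasurable (fun q : ℝ × ℝ³ => ENNReal.ofReal (frobeniusNormSq (G q.1 q.2)))
      ((volume.restrict I).prod (volume.restrict B)) := by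
    rw [← hprod]
    exact (SereginZajaczkowski2007.continuous_frobeniusNormSq.comp_aestronglyMeasurable
      hGm).aemeasurable.ennreal_ofReal
  have ham : AEMeasurable a (volume.restrict I) := hum2.lintegral_prod_right'
  have hem : AEMeasurable e (volume.restrict I) := hGm2.lintegral_prod_right'
  -- (i) `∫_I e = ∫∫_{I × B} |G|² ≤ ρ E`
  have hIe : ∫⁻ t in I, e t ≤ ENNReal.ofReal ρ * E := by
    calc ∫⁻ t in I, e t = ∫⁻ q in I ×ˢ B, ENNReal.ofReal (frobeniusNormSq (G q.1 q.2)) := by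
          rw [hprod, lintegral_prod _ hGm2]
      _ ≤ ∫⁻ q in parCyl z ρ, ENNReal.ofReal (frobeniusNormSq (G q.1 q.2)) :=
          lintegral_mono_set hIB
      _ = ENNReal.ofReal ρ * E := setLIntegral_eq_mul_dissipationE z hρ0 G
  -- (ii) a.e. in `t ∈ I`: energy bound, finiteness of `e`, weak derivative of the slice, (r4)
  have h1 : ∀ᵐ t ∂(volume.restrict I), a t ≤ ENNReal.ofReal ρ * A := by
    have h := ae_restrict_of_ae_restrict_of_subset hIρ (ae_lintegral_sq_le_energyA z hρ0 u)
    filter_upwards [h] with t ht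
    exact (lintegral_mono_set hBS).trans ht
  have h2 : ∀ᵐ t ∂(volume.restrict I), e t < ∞ := by
    refine ae_lt_top' hem (ne_top_of_le_ne_top ?_ hIe)
    exact ENNReal.mul_ne_top ENNReal.ofReal_ne_top hEt
  have h3 : ∀ᵐ t ∂(volume.restrict I), FunctionSpaces.HasWeakFDerivOn
      (⟨B, isOpen_ball⟩ : Opens ℝ³) volume (u t) (G t) := by
    have hG' : HasWeakSpatialGradientOn
        (⟨Ioo (-r ^ 2) 0 ×ˢ ((⟨B, isOpen_ball⟩ : Opens ℝ³) : Set ℝ³),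
          isOpen_Ioo.prod isOpen_ball⟩ : Opens (ℝ × ℝ³)) u G :=
      hG.mono (fun q hq => hIB1 hq)
    exact hG'.ae_hasWeakFDerivOn_slice
  have h4 : ∀ᵐ t ∂(volume.restrict I), ∀ᵐ x ∂(volume.restrict B),
      cylRadius x * ‖u t x‖ ≤ C := by
    have h := ae_restrict_of_ae_restrict_of_subset hIB1 hr4
    exact ae_ae_of_ae_restrict_prod (P := fun q : ℝ × ℝ³ => cylRadius q.2 * ‖u q.1 q.2‖ ≤ C) h
  -- the weight on `B`
  set W : ℝ≥0∞ := ∫⁻ x in B, (ENNReal.ofReal (cylRadius x))⁻¹ ^ (12 / 7 : ℝ) with hW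
  have hWle : W ≤ 2 * V₁ * ENNReal.ofReal ρ ^ (9 / 7 : ℝ) := by
    calc W ≤ ∫⁻ x in spaceCyl (b • eZ) ρ, (ENNReal.ofReal (cylRadius x))⁻¹ ^ (12 / 7 : ℝ) :=
          lintegral_mono_set hBS
      _ = ENNReal.ofReal (2 * ρ) * (ENNReal.ofReal ρ ^ (2 / 7 : ℝ) * V₁) :=
          lintegral_inv_cylRadius_rpow_spaceCyl b hρ0
      _ = 2 * V₁ * ENNReal.ofReal ρ ^ (9 / 7 : ℝ) := by
          rw [ENNReal.ofReal_mul zero_le_two, ENNReal.ofReal_ofNat,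
            show (9 / 7 : ℝ) = 1 + 2 / 7 by norm_num,
            ENNReal.rpow_add _ _ hρ0' ENNReal.ofReal_ne_top, ENNReal.rpow_one]
          ring
  have hWt : W ≠ ∞ := ne_top_of_le_ne_top (ENNReal.mul_ne_top (ENNReal.mul_ne_top (by simp) hV₁t)
    (ENNReal.rpow_ne_top_of_nonneg (by norm_num) ENNReal.ofReal_ne_top)) hWle
  -- (iii) the slice estimate
  set M : ℝ≥0∞ := K ^ (6 / 5 : ℝ) * W ^ (7 / 10 : ℝ) * CS with hM
  have hMt : M ≠ ∞ := ENNReal.mul_ne_top (ENNReal.mul_ne_top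
    (ENNReal.rpow_ne_top_of_nonneg (by norm_num) hKt)
    (ENNReal.rpow_ne_top_of_nonneg (by norm_num) hWt)) ENNReal.coe_ne_top
  set X : ℝ → ℝ≥0∞ := fun t => (ENNReal.ofReal ρ)⁻¹ ^ 2 * a t + e t with hX
  have hXm : AEMeasurable X (volume.restrict I) := (ham.const_mul _).add hem
  have hslice : ∀ᵐ t ∂(volume.restrict I),
      ∫⁻ x in S, ‖u t x‖ₑ ^ (3 : ℕ) ≤ M * X t ^ (9 / 10 : ℝ) := by
    filter_upwards [h1, h2, h3, h4] with t hat het hwt hr4t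
    have hat' : a t ≠ ∞ := ne_top_of_le_ne_top (ENNReal.mul_ne_top ENNReal.ofReal_ne_top hAt) hat
    have hutm : AEStronglyMeasurable (u t) (volume.restrict B) :=
      hwt.locallyIntegrableOn.aestronglyMeasurable
    -- the weighted bound on `B`
    have hfw : ∀ᵐ x ∂(volume.restrict B), ENNReal.ofReal (cylRadius x) * ‖u t x‖ₑ ≤ K := by
      filter_upwards [hr4t] with x hx
      rw [← ofReal_norm, ← ENNReal.ofReal_mul (cylRadius_nonneg _)]
      calc ENNReal.ofReal (cylRadius x * ‖u t x‖) ≤ ENNReal.ofReal C := ENNReal.ofReal_le_ofReal hx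
        _ = (C : ℝ≥0∞) := ENNReal.ofReal_coe_nnreal
        _ ≤ K := le_self_add
    have hwH := lintegral_cube_le_weighted (volume.restrict B) (f := fun x => ‖u t x‖ₑ)
      (w := fun x => ENNReal.ofReal (cylRadius x)) hutm.enorm
      continuous_cylRadius.measurable.ennreal_ofReal.aemeasurable hK0 hKt hfw
    have hSob := hCS (b • eZ) ρ hρ0 (u t) (G t) hwt hat' het.ne
    calc ∫⁻ x in S, ‖u t x‖ₑ ^ (3 : ℕ) ≤ ∫⁻ x in B, ‖u t x‖ₑ ^ (3 : ℕ) := lintegral_mono_set hSB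
      _ ≤ K ^ (6 / 5 : ℝ) * W ^ (7 / 10 : ℝ) * (∫⁻ x in B, ‖u t x‖ₑ ^ (6 : ℝ)) ^ (3 / 10 : ℝ) := hwH
      _ ≤ K ^ (6 / 5 : ℝ) * W ^ (7 / 10 : ℝ) * (CS * X t ^ (9 / 10 : ℝ)) := by gcongr
      _ = M * X t ^ (9 / 10 : ℝ) := by rw [hM]; ring
  -- (iv) integrate in time
  have hvolI : (volume.restrict I) univ = ENNReal.ofReal (r ^ 2) := by
    rw [Measure.restrict_apply_univ, hI, Real.volume_Ioo]; congr 1; ring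
  have hIX : ∫⁻ t in I, X t ≤ ENNReal.ofReal ρ * (A + E) := by
    have hIa : ∫⁻ t in I, a t ≤ ENNReal.ofReal (r ^ 2) * ENNReal.ofReal ρ * A := by
      calc ∫⁻ t in I, a t ≤ ∫⁻ _ in I, ENNReal.ofReal ρ * A := lintegral_mono_ae h1
        _ = ENNReal.ofReal ρ * A * (volume.restrict I) univ := lintegral_const _
        _ = ENNReal.ofReal (r ^ 2) * ENNReal.ofReal ρ * A := by rw [hvolI]; ring
    have hct : (ENNReal.ofReal ρ)⁻¹ ^ 2 ≠ ∞ := ENNReal.pow_ne_top (ENNReal.inv_ne_top.2 hρ0')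
    calc ∫⁻ t in I, X t = (ENNReal.ofReal ρ)⁻¹ ^ 2 * (∫⁻ t in I, a t) + ∫⁻ t in I, e t := by
          rw [hX, lintegral_add_left' (ham.const_mul _), lintegral_const_mul' _ _ hct]
      _ ≤ (ENNReal.ofReal ρ)⁻¹ ^ 2 * (ENNReal.ofReal (r ^ 2) * ENNReal.ofReal ρ * A) +
            ENNReal.ofReal ρ * E := add_le_add (mul_le_mul_right hIa _) hIe
      _ = (ENNReal.ofReal ρ)⁻¹ ^ 2 * (ENNReal.ofReal (r ^ 2) * ENNReal.ofReal ρ) * A +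
            ENNReal.ofReal ρ * E := by ring
      _ ≤ ENNReal.ofReal ρ * A + ENNReal.ofReal ρ * E := by
          gcongr
          rw [hρ]
          exact inv_sq_mul_le hr
      _ = ENNReal.ofReal ρ * (A + E) := by ring
  have htime : ∫⁻ t in I, ∫⁻ x in S, ‖u t x‖ₑ ^ (3 : ℕ) ≤
      M * (ENNReal.ofReal (r ^ 2) ^ (1 / 10 : ℝ) * (ENNReal.ofReal ρ * (A + E)) ^ (9 / 10 : ℝ)) := by
    calc ∫⁻ t in I, ∫⁻ x in S, ‖u t x‖ₑ ^ (3 : ℕ)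
        ≤ ∫⁻ t in I, M * X t ^ (9 / 10 : ℝ) := lintegral_mono_ae hslice
      _ = M * ∫⁻ t in I, X t ^ (9 / 10 : ℝ) := lintegral_const_mul' _ _ hMt
      _ ≤ M * ((volume.restrict I) univ ^ (1 / 10 : ℝ) * (∫⁻ t in I, X t) ^ (9 / 10 : ℝ)) := by
          gcongr
          exact lintegral_rpow_nine_tenths_le _ hXm
      _ ≤ M * (ENNReal.ofReal (r ^ 2) ^ (1 / 10 : ℝ) * (ENNReal.ofReal ρ * (A + E)) ^ (9 / 10 : ℝ)) := by
          rw [hvolI]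
          gcongr
  -- (v) Tonelli and the cancellation of the powers of `r`
  set R : ℝ≥0∞ := ENNReal.ofReal r with hR
  have hR0 : R ≠ 0 := (ENNReal.ofReal_pos.2 hr).ne'
  have hRt : R ≠ ∞ := ENNReal.ofReal_ne_top
  have hρR : ENNReal.ofReal ρ = 2 * R := by
    rw [hρ, ENNReal.ofReal_mul zero_le_two, ENNReal.ofReal_ofNat]
  have hr2R : ENNReal.ofReal (r ^ 2) = R ^ 2 := by rw [hR, ENNReal.ofReal_pow hr.le]
  have hmain : ∫⁻ q in parCyl z r, ‖u q.1 q.2‖ₑ ^ (3 : ℕ) ≤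
      K₀ * K ^ (6 / 5 : ℝ) * R ^ 2 * (A + E) ^ (9 / 10 : ℝ) := by
    calc ∫⁻ q in parCyl z r, ‖u q.1 q.2‖ₑ ^ (3 : ℕ)
        = ∫⁻ q in I ×ˢ S, ‖u q.1 q.2‖ₑ ^ (3 : ℕ) := by rw [hQ]
      _ ≤ ∫⁻ t in I, ∫⁻ x in S, ‖u t x‖ₑ ^ (3 : ℕ) := by
          rw [Measure.volume_eq_prod, ← Measure.prod_restrict]
          exact lintegral_prod_le _
      _ ≤ M * (ENNReal.ofReal (r ^ 2) ^ (1 / 10 : ℝ) * (ENNReal.ofReal ρ * (A + E)) ^ (9 / 10 : ℝ)) :=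
          htime
      _ ≤ (K ^ (6 / 5 : ℝ) * (2 * V₁ * ENNReal.ofReal ρ ^ (9 / 7 : ℝ)) ^ (7 / 10 : ℝ) * CS) *
            (ENNReal.ofReal (r ^ 2) ^ (1 / 10 : ℝ) *
              (ENNReal.ofReal ρ ^ (9 / 10 : ℝ) * (A + E) ^ (9 / 10 : ℝ))) := by
          rw [← ENNReal.mul_rpow_of_nonneg _ _ (by norm_num : (0 : ℝ) ≤ 9 / 10)]
          have hMle : M ≤ K ^ (6 / 5 : ℝ) * (2 * V₁ * ENNReal.ofReal ρ ^ (9 / 7 : ℝ)) ^ (7 / 10 : ℝ) * CS := by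
            rw [hM]; gcongr
          exact mul_le_mul_left hMle _
      _ = (K ^ (6 / 5 : ℝ) * (2 * V₁ * (2 * R) ^ (9 / 7 : ℝ)) ^ (7 / 10 : ℝ) * CS *
            (R ^ 2) ^ (1 / 10 : ℝ) * (2 * R) ^ (9 / 10 : ℝ)) * (A + E) ^ (9 / 10 : ℝ) := by
          rw [hρR, hr2R]; ring
      _ = K₀ * K ^ (6 / 5 : ℝ) * R ^ 2 * (A + E) ^ (9 / 10 : ℝ) := by
          rw [radius_powers_identity hR0 hRt V₁ CS (K ^ (6 / 5 : ℝ)), hK₀]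
  -- conclusion
  have hR2 : R ^ 2 ≠ 0 := pow_ne_zero _ hR0
  have hR2t : R ^ 2 ≠ ∞ := ENNReal.pow_ne_top hRt
  calc cubicC z r u = (R ^ 2)⁻¹ * ∫⁻ q in parCyl z r, ‖u q.1 q.2‖ₑ ^ (3 : ℕ) := by
        rw [cubicC, hR]
    _ ≤ (R ^ 2)⁻¹ * (K₀ * K ^ (6 / 5 : ℝ) * R ^ 2 * (A + E) ^ (9 / 10 : ℝ)) := by gcongr
    _ = K₀ * K ^ (6 / 5 : ℝ) * (A + E) ^ (9 / 10 : ℝ) := by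
        calc (R ^ 2)⁻¹ * (K₀ * K ^ (6 / 5 : ℝ) * R ^ 2 * (A + E) ^ (9 / 10 : ℝ))
            = ((R ^ 2)⁻¹ * R ^ 2) * (K₀ * K ^ (6 / 5 : ℝ) * (A + E) ^ (9 / 10 : ℝ)) := by ring
          _ = _ := by rw [ENNReal.inv_mul_cancel hR2 hR2t, one_mul]
    _ ≤ (K₀ + 1) * K ^ (6 / 5 : ℝ) * (A + E) ^ (9 / 10 : ℝ) := by
        gcongr
        exact le_self_add

end SereginSverak2009

end Literature.Analysis.FluidPDE
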